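import Summits.RiemannHypothesis.RiemannHypothesis.Theses.DensityLadder
import Literature.Barriers.RiemannHypothesis.LindelofBacklund
import Literature.Barriers.RiemannHypothesis.LindelofBacklundProofs

/-!
# Birth skeleton (BC3) for crux `LadderResidual` — route `DensityLadder`, item stmt-RiemannHypothesis-19602

The crux, BY NAME, is the route's DECLARED RESIDUAL
`Summit.RiemannHypothesis.RiemannHypothesis.Theses.DensityLadder.LadderResidual :=
BeatThirtyThirteenths → DensityBelowBourgain → Summit.RiemannHypothesis`
("the two rungs imply RH"; summit-strength BY DESIGN, never a prover target, exempt from T3/T4;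
the route lives on the FRONTIER ledger).  This file does not claim progress on it.  It records,
at their clean seams and in the tree's own zero-count vocabulary, the three gaps the route header
itself names as "what the ladder does not reach" (route file, item docstring): the remaining
density rungs down to the Density Hypothesis; DH → Lindelöf-type sparsity; counts → emptiness.
Each seam is a NAMED open implication of the classical hierarchy
`RH ⇒ LH ⇔ Backlund ⇒ DH ⇒ A ≤ 30/13` (every arrow of which is a tree theorem:
`Literature.NumberTheory.LFunctions.lindelofHypothesis_of_riemannHypothesis_holds`,
`Literature.Barriers.RiemannHypothesis.Titchmarsh1986_thm13_5_holds`,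
`Literature.NumberTheory.LFunctions.DensityHypothesis.of_lindelofHypothesis` with
`Titchmarsh1986_sec9_18_lindelofDensity_holds`,
`Literature.NumberTheory.LFunctions.DensityHypothesis.zeroDensity_thirty_thirteenths`), read
UPWARDS:

* `stub_densityHypothesis_of_rungs` (OPEN): the two attacked rungs — a uniform exponent
  `A < 30/13` on `[1/2, 1]` and `A(σ) ≤ 2` from some `σ₀ < 25/32` — imply the Density Hypothesis
  `Literature.NumberTheory.LFunctions.DensityHypothesis = ZeroDensityEstimate (fun _ ↦ 2) (1/2)`
  (Ivić (1.137)/(11.3); Tao–Trudgian–Yang Conjecture 38).  "The remaining density rungs down to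
  DH": weaker than DH outright (it may use the rungs), open because DH is (best uniform exponent
  30/13, DH known only right of 25/32).
* `stub_backlund_of_densityHypothesis` (OPEN): DH implies Backlund's zero condition
  `Literature.Barriers.RiemannHypothesis.BacklundZeroCondition`
  (`N(σ, T+1) − N(σ, T) = o(log T)` for every `σ > 1/2`), which is EQUIVALENT to the Lindelöf
  hypothesis (Titchmarsh Thm 13.5, tree `Titchmarsh1986_thm13_5_holds`).  "DH → LH-type
  sparsity": the converse of Ingham 1940 (LH ⇒ DH, tree `DensityHypothesis.of_lindelofHypothesis`),
  open; a global count exponent `2(1−σ)` says nothing about `o(log T)` zeros per unit window.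
* `stub_rh_of_backlund` (OPEN, summit-strength — the residual's core): Backlund's `o(log T)`
  local sparsity right of every `σ > 1/2` implies that there are NO such zeros, i.e. RH.
  "Counts → emptiness": exactly the catalogued barrier
  `Literature.Barriers.RiemannHypothesis.LindelofBacklund` head-on (Titchmarsh §13.1: "the
  converse deduction cannot be made"); RH gives the hypothesis trivially
  (`backlundZeroCondition_of_riemannHypothesis`, proved), so the stub is `LH ⇒ RH` in zero-count
  currency.  It is here because the crux is the declared residual: at least one piece of any
  decomposition of a summit-strength statement is summit-strength, and this file NAMES it rather
  than hiding it.

`LadderResidual_of : <stub₁> → <stub₂> → <stub₃> → DensityLadder.LadderResidual` is the real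
composition (thread the two rungs through the three implications; the crux unfolds BY NAME to
`BeatThirtyThirteenths → DensityBelowBourgain → Summit.RiemannHypothesis`);
`LadderResidual_proof` feeds it the three sorried stubs.  Sorries: exactly
`stub_densityHypothesis_of_rungs`, `stub_backlund_of_densityHypothesis`, `stub_rh_of_backlund`.

Every stub is a consequence of RH (materially: RH ⇒ DH, RH ⇒ Backlund, RH), so none contradicts
the believed truth; none is cheaply the crux or the summit (BC3 probes, folder `bc/`):
stub₁ ⇏ R needs DH ⇒ RH; stub₂ ⇏ R needs rungs ⇒ DH and Backlund ⇒ RH; stub₃ ⇏ R needs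
rungs ⇒ Backlund; stubᵢ ⇏ RH needs DH / Backlund, both registered OPEN conjectures with no
`_holds` in the tree.  Disproof used: none on file (`ledger crux ls stmt-RiemannHypothesis-19602`:
no `Disproof.lean`, no `Negative/`); `ledger negatives --problem RiemannHypothesis` (2 entries:
CharacterSums, UniversalFactor) is unrelated to zero counts.
-/

namespace Summit.RiemannHypothesis.RiemannHypothesis.Cruxes.LadderResidual.Birth

open Summit.RiemannHypothesis.RiemannHypothesis.Theses.DensityLadder

/-! ## The registered stubs (full signatures over importable declarations; `sorry` lives only here) -/

/-- **Stub 1 (OPEN) — the remaining density rungs down to the Density Hypothesis.** A uniform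
zero-density exponent `A < 30/13` on `[1/2, 1]` (`BeatThirtyThirteenths`) and the Density
Hypothesis from some abscissa `σ₀ < 25/32` (`DensityBelowBourgain`) imply the Density Hypothesis
on the whole range, `N(σ, T) ≪_ε T^{2(1−σ)+ε}` for `1/2 ≤ σ ≤ 1`
(`Literature.NumberTheory.LFunctions.DensityHypothesis`; Ivić 1985 (1.137), (11.3);
Tao–Trudgian–Yang 2025 Conjecture 38 — OPEN: best uniform exponent `30/13`, Guth–Maynard 2024).
[cite: Ivic1985, (1.137) and ch. 11 (11.3)] [cite: TaoTrudgianYang2025, Conjecture 38]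
[cite: GuthMaynard2024, Theorem 1.1] -/
theorem stub_densityHypothesis_of_rungs :
    BeatThirtyThirteenths → DensityBelowBourgain →
      Literature.NumberTheory.LFunctions.DensityHypothesis := by
  sorry

/-- **Stub 2 (OPEN) — DH → Lindelöf-type sparsity.** The Density Hypothesis implies Backlund's
zero condition: for every `σ > 1/2`, `N(σ, T+1) − N(σ, T) = o(log T)`
(`Literature.Barriers.RiemannHypothesis.BacklundZeroCondition`, equivalent to the Lindelöf
hypothesis by Titchmarsh Thm 13.5, tree `Titchmarsh1986_thm13_5_holds`).  The converse direction
LH ⇒ DH is Ingham 1940 (tree `DensityHypothesis.of_lindelofHypothesis`); this one is open.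
[cite: Titchmarsh1986, Theorem 13.5 and §9.18] [cite: Ingham1940] -/
theorem stub_backlund_of_densityHypothesis :
    Literature.NumberTheory.LFunctions.DensityHypothesis →
      Literature.Barriers.RiemannHypothesis.BacklundZeroCondition := by
  sorry

/-- **Stub 3 (OPEN, summit-strength: the residual's core) — counts → emptiness.** Backlund's
`o(log T)` sparsity of zeros in unit windows right of every `σ > 1/2` implies that there are no
zeros off the critical line at all (RH).  This is the catalogued barrier
`Literature.Barriers.RiemannHypothesis.LindelofBacklund` head-on ("the converse deduction
[LH ⇒ RH] cannot be made", Titchmarsh §13.1); RH ⇒ the hypothesis is the proved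
`Literature.Barriers.RiemannHypothesis.backlundZeroCondition_of_riemannHypothesis`.
[cite: Titchmarsh1986, §13.1 and Theorem 13.5] -/
theorem stub_rh_of_backlund :
    Literature.Barriers.RiemannHypothesis.BacklundZeroCondition → Summit.RiemannHypothesis := by
  sorry

/-! ## The composition (proved, no `sorry`): the crux BY NAME from the three stub statements -/

/-- `stub_densityHypothesis_of_rungs → stub_backlund_of_densityHypothesis → stub_rh_of_backlund →
LadderResidual` (the route decl, by name): given the two rungs, climb DH → Backlund → RH. -/
theorem LadderResidual_of
    (h₁ : BeatThirtyThirteenths → DensityBelowBourgain →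
      Literature.NumberTheory.LFunctions.DensityHypothesis)
    (h₂ : Literature.NumberTheory.LFunctions.DensityHypothesis →
      Literature.Barriers.RiemannHypothesis.BacklundZeroCondition)
    (h₃ : Literature.Barriers.RiemannHypothesis.BacklundZeroCondition → Summit.RiemannHypothesis) :
    Summit.RiemannHypothesis.RiemannHypothesis.Theses.DensityLadder.LadderResidual := by
  -- the crux, by name, is `BeatThirtyThirteenths → DensityBelowBourgain → Summit.RiemannHypothesis`
  show BeatThirtyThirteenths → DensityBelowBourgain → Summit.RiemannHypothesis
  intro hX₁ hX₂
  exact h₃ (h₂ (h₁ hX₁ hX₂))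

/-- **The skeleton**: the crux BY NAME from the three registered stubs (sorries only inside
them). -/
theorem LadderResidual_proof :
    Summit.RiemannHypothesis.RiemannHypothesis.Theses.DensityLadder.LadderResidual :=
  LadderResidual_of stub_densityHypothesis_of_rungs stub_backlund_of_densityHypothesis
    stub_rh_of_backlund

end Summit.RiemannHypothesis.RiemannHypothesis.Cruxes.LadderResidual.Birth
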